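import Summits.BirchSwinnertonDyer.BirchSwinnertonDyer.Theorems.SylvesterTwoHeegnerIndexCMDataGeomPackage
import Summits.BirchSwinnertonDyer.Rank1Residual.X11b.KolyvaginH44ConcreteData
import HarnessLib

/-!
# DATA LAYER (R-g) of leaf (L1), crux `UpperOffV0HSYPlus` (stmt-BirchSwinnertonDyer-19804): the COUPLED
# CM frame of the pair `(E_p, E_{3p²})` — ONE cube root `v_B` (`v_B³ = p/9`), `v_A = 3v_B²` (`v_A³ = p²/3`),
# transports `ψ_B`, `ψ_A`, ONE cocycle `ρ` with `ρ_A = ρ ∘ ρ` — in the binder shape of k-ty1 #14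

Skeleton of record VARIANT M (`Cruxes/UpperOffV0HSYPlus/Lines/coupled_variantM.lean` 406ca288e244d392); card
v25.  The rows' residual on leaf (L1) is the AT-LEVEL FLIP (F) = one call of k-ty1 #14
`JZero.zsmul_kolyvaginClass_cubicTwist_mem_selmerLocalKer_iff_mem_torsionLocalKer` (p650073), whose frame
binders COUPLE the two twists: `ψ₁`, `ψ₂` scaling by `v₁`, `v₂`, cocycles `ρ`, `ρ'` with
`ρ' g x = ρ g (ρ g x)` (`χ_A = χ_B²`), `hρcomm`, `N ⊴ Γ_K` with abelian quotient (`hcomm`), representatives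
`t`, admissible `A_i = ψ_i(E₉(K̄)^N)`, and `ψ₁(P_n^χ)`, `ψ₂(P_m^{χ̄})` in `invPoints`.  The per-twist recipe
calls of #R-d/#R-f choose INDEPENDENT cube roots; this file supplies the COUPLED frame and, at any level
`K[m]`, the level package in #14's shape:

* `exists_coupledFrame` — `∃ v_B v_A ψ_B ψ_A ρ`: `v_B³ = p/9`, `v_A = 3·v_B²`, `v_A³ = p²/3`, the coordinate
  descriptions of `ψ_B`, `ψ_A`, `ρ` (w.r.t. `v_B`) and of `ρ ∘ ρ` (w.r.t. `v_A`), the twist laws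
  `g • ψ_B P = ψ_B (ρ g (g • P))`, `g • ψ_A P = ψ_A (ρ g (ρ g (g • P)))`, `hρcomm`, `(g v_i)³ = v_i³`
  (`exists_cmFrame_transport` for `v_B`; `exists_cubicTwist_transport_cubeSumCurve` at the GIVEN `v_A`;
  `smul_cubicTwist_of_apply_eq`);
* `coupledFrame_levelPackage` — for an embedded `K[9pn]` (`emb`, `N` its fixing subgroup, `N'` the subgroup
  fixing the `K[9p]`-part, `t` representatives of `Γ_K/N'`): `N ⊴ Γ_K`, `Γ_K/N` abelian (`hcomm`, from x11b3
  `isMulCommutative_ringClassGal'`), `N` and `N'` fix `v_B`, `v_A`, both `ψ_i(E₉(K̄)^N)` admissible at `2^M`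
  (`h6`), and for EVERY `P ∈ E₉(K̄)^N` whose class mod `2^M` is `N'`-invariant (the `hP` of #R-c/#R-f):
  `ψ_B(Σᵢ ρ(tᵢ)(tᵢ • P)) ∈ invPoints Γ_K A_B 2^M` and `ψ_A(Σᵢ ρ(tᵢ)(ρ(tᵢ)(tᵢ • P))) ∈ invPoints Γ_K A_A 2^M`.

HONEST FRAMING: theorems only (no definition, no named fact, no instance, no notation); assembly of PROVED
tree theorems; nothing about Sel/Ш/the FLIP itself/the height display/BSD; no stub closed;
`--supports stmt-BirchSwinnertonDyer-19804 --as helper`.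

## References
* B. H. Gross, LMS LNS 153 (1991), §4 (4.1)–(4.4), Lemma 4.3, §12 (y_χ). [GrossLMS1991]
* Y. Hu, J. Shu, H. Yin, Trans. AMS 372 (2019), arXiv 1708.05266 §1 p. 4 (χ), §2 p. 8, Prop. 2.4. [HuShuYin2019]
* J. H. Silverman, *AEC*, X.2.2, X.5.4. [SilvermanAEC2009]

## Mathlib / tree search
Tree: `HuShuYin2019.exists_cmFrame_transport`, `exists_cubicTwist_transport_cubeSumCurve`,
`JZero.smul_cubicTwist_of_apply_eq`, `JZero.smul_rho_of_omega`, `JZero.pow_three_smul_eq`,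
`HuShuYin2019.isAdmissible_map_fixedPoints_cubeSumCurve_nine`, `JZero.cubicTwist_chiComponent_fixedPoints_mem_invPoints`
(`CubicTwistTransportJZero`, `CubicTwistKolyvaginClassesJZero`); x11b3 `KolyvaginH44.isMulCommutative_ringClassGal'`;
`exists_algEquiv_comp_eq` (`GeomPointsEmbeddingDescent`); #R-c. `lean search 'coupledFrame'` → nothing before this file.
presearch: n/a (assembly).
-/

set_option linter.dupNamespace false -- Summits modules are `Summit.<Summit>.<Problem>…` by design

noncomputable section

open scoped Classical

namespace Summit.BirchSwinnertonDyer.BirchSwinnertonDyer.Theorems.SylvesterTwoCMData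

open Complex NumberField WeierstrassCurve
open Literature.NumberTheory.EllipticCurves Literature.NumberTheory.EllipticCurves.ModularForms
  Literature.NumberTheory.EllipticCurves.HuShuYin2019
  Summit.BirchSwinnertonDyer.Rank1Residual.X11b

variable {K : Type} [Field K] [NumberField K]

/-- `∃ ψ ρ` for the cubic twist `E₉ ≅ E_b`, `b = 9c`, at a GIVEN cube root `v` of `c` (the `b`-free form of
`exists_cubicTwist_transport_cubeSumCurve`). [cite: HuShuYin2019, §2 p. 8] -/
private theorem exists_cubicTwist_transport_of_eq {b c : ℚ} (hc : c ≠ 0) (hb : b = 9 * c)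
    {v : AlgebraicClosure K} (hvc : v ^ 3 = algebraMap ℚ (AlgebraicClosure K) c) :
    ∃ (ψ : geomPoints ((cubeSumCurve 9).baseChange K) ≃+ geomPoints ((cubeSumCurve b).baseChange K))
      (ρ : Field.absoluteGaloisGroup K →
        geomPoints ((cubeSumCurve 9).baseChange K) ≃+ geomPoints ((cubeSumCurve 9).baseChange K)),
      (∀ {x y : AlgebraicClosure K}
        (h : (((cubeSumCurve 9).baseChange K).baseChange (AlgebraicClosure K)).toAffine.Nonsingular x y),
        ∃ h', ψ (Affine.Point.some x y h) = Affine.Point.some (v ^ 2 * x) (v ^ 3 * y) h') ∧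
      (∀ (g : Field.absoluteGaloisGroup K) {x y : AlgebraicClosure K}
        (h : (((cubeSumCurve 9).baseChange K).baseChange (AlgebraicClosure K)).toAffine.Nonsingular x y),
        ∃ h', ρ g (Affine.Point.some x y h) =
          Affine.Point.some (((show AlgebraicClosure K ≃ₐ[K] AlgebraicClosure K from g) v / v) ^ 2 * x)
            y h') ∧
      ∀ (g : Field.absoluteGaloisGroup K) (P : geomPoints ((cubeSumCurve 9).baseChange K)),
        g • ψ P = ψ (ρ g (g • P)) := by
  subst hb
  exact exists_cubicTwist_transport_cubeSumCurve K 9 c hc hvc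

/-- **THE COUPLED CM FRAME of the pair `(E_p, E_{3p²})`** over `K ∋ ω` (`p ≠ 0`): ONE cube root `v_B` with
`v_B³ = p/9`, `v_A = 3 v_B²` (so `v_A³ = p²/3` and `g v_A / v_A = (g v_B / v_B)²`: `χ_A = χ_B²`), transports
`ψ_B : E₉(K̄) ≃+ E_p(K̄)`, `ψ_A : E₉(K̄) ≃+ E_{3p²}(K̄)` scaling by `(v_B², v_B³)`, `(v_A², v_A³)`, ONE cocycle
`ρ_g = [(g v_B/v_B)²]` with `ρ_g ∘ ρ_g = [(g v_A/v_A)²]`, the twist laws `g • ψ_B P = ψ_B (ρ_g (g P))`,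
`g • ψ_A P = ψ_A (ρ_g (ρ_g (g P)))`, `h ρ_g = ρ_g h` (`μ₃ ⊂ K`) and `(g v_i)³ = v_i³` — the frame binders
`hψ₁ hψ₂ ρ ρ' hρ' hρcomm` of k-ty1 #14 with `ρ' := ρ ∘ ρ`. [cite: HuShuYin2019, §1 p. 4, §2 p. 8]
[cite: SilvermanAEC2009, X.2.2, X.5.4] -/
theorem exists_coupledFrame {ω : K} (hω : ω ^ 2 + ω + 1 = 0) {p : ℕ} (hp0 : p ≠ 0) :
    ∃ (vB vA : AlgebraicClosure K)
      (ψB : geomPoints ((cubeSumCurve 9).baseChange K) ≃+ geomPoints ((cubeSumCurve (p : ℚ)).baseChange K))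
      (ψA : geomPoints ((cubeSumCurve 9).baseChange K) ≃+
        geomPoints ((cubeSumCurve (3 * (p : ℚ) ^ 2)).baseChange K))
      (ρ : Field.absoluteGaloisGroup K →
        geomPoints ((cubeSumCurve 9).baseChange K) ≃+ geomPoints ((cubeSumCurve 9).baseChange K)),
      vB ^ 3 = algebraMap ℚ (AlgebraicClosure K) ((p : ℚ) / 9) ∧ vB ≠ 0 ∧
      vA = 3 * vB ^ 2 ∧ vA ^ 3 = algebraMap ℚ (AlgebraicClosure K) ((p : ℚ) ^ 2 / 3) ∧ vA ≠ 0 ∧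
      (∀ g : Field.absoluteGaloisGroup K,
        ((show AlgebraicClosure K ≃ₐ[K] AlgebraicClosure K from g) vB) ^ 3 = vB ^ 3) ∧
      (∀ g : Field.absoluteGaloisGroup K,
        ((show AlgebraicClosure K ≃ₐ[K] AlgebraicClosure K from g) vA) ^ 3 = vA ^ 3) ∧
      (∀ {x y : AlgebraicClosure K}
        (h : (((cubeSumCurve 9).baseChange K).baseChange (AlgebraicClosure K)).toAffine.Nonsingular x y),
        ∃ h', ψB (Affine.Point.some x y h) = Affine.Point.some (vB ^ 2 * x) (vB ^ 3 * y) h') ∧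
      (∀ {x y : AlgebraicClosure K}
        (h : (((cubeSumCurve 9).baseChange K).baseChange (AlgebraicClosure K)).toAffine.Nonsingular x y),
        ∃ h', ψA (Affine.Point.some x y h) = Affine.Point.some (vA ^ 2 * x) (vA ^ 3 * y) h') ∧
      (∀ (g : Field.absoluteGaloisGroup K) {x y : AlgebraicClosure K}
        (h : (((cubeSumCurve 9).baseChange K).baseChange (AlgebraicClosure K)).toAffine.Nonsingular x y),
        ∃ h', ρ g (Affine.Point.some x y h) =
          Affine.Point.some (((show AlgebraicClosure K ≃ₐ[K] AlgebraicClosure K from g) vB / vB) ^ 2 * x)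
            y h') ∧
      (∀ (g : Field.absoluteGaloisGroup K) {x y : AlgebraicClosure K}
        (h : (((cubeSumCurve 9).baseChange K).baseChange (AlgebraicClosure K)).toAffine.Nonsingular x y),
        ∃ h', ρ g (ρ g (Affine.Point.some x y h)) =
          Affine.Point.some (((show AlgebraicClosure K ≃ₐ[K] AlgebraicClosure K from g) vA / vA) ^ 2 * x)
            y h') ∧
      (∀ (g : Field.absoluteGaloisGroup K) (P : geomPoints ((cubeSumCurve 9).baseChange K)),
        g • ψB P = ψB (ρ g (g • P))) ∧
      (∀ (g : Field.absoluteGaloisGroup K) (P : geomPoints ((cubeSumCurve 9).baseChange K)),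
        g • ψA P = ψA (ρ g (ρ g (g • P)))) ∧
      (∀ (g h : Field.absoluteGaloisGroup K) (P : geomPoints ((cubeSumCurve 9).baseChange K)),
        h • ρ g P = ρ g (h • P)) := by
  have hp0' : (p : ℚ) ≠ 0 := by exact_mod_cast hp0
  -- the `B`-frame: `v_B`, `ψ_B`, `ρ`
  obtain ⟨vB, ψB, ρ, hvBc, hvB, hvB3, hψB, hρ, hlawB, -, hρcomm, -⟩ :=
    exists_cmFrame_transport K hω 9 (p : ℚ) ((p : ℚ) / 9) (by positivity) (by ring)
  -- `v_A = 3 v_B²`, `v_A³ = 27 v_B⁶ = p²/3`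
  set vA : AlgebraicClosure K := 3 * vB ^ 2 with hvA
  have hvAc : vA ^ 3 = algebraMap ℚ (AlgebraicClosure K) ((p : ℚ) ^ 2 / 3) := by
    have e : vA ^ 3 = 27 * (vB ^ 3) ^ 2 := by rw [hvA]; ring
    rw [e, hvBc, ← map_pow, eq_ratCast, eq_ratCast]
    push_cast
    ring
  have hvA0 : vA ≠ 0 := by
    rw [hvA]; exact mul_ne_zero (by norm_num) (pow_ne_zero 2 hvB)
  have hvA3 : ∀ g : Field.absoluteGaloisGroup K,
      ((show AlgebraicClosure K ≃ₐ[K] AlgebraicClosure K from g) vA) ^ 3 = vA ^ 3 := by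
    intro g
    have hvAc' : vA ^ 3 = algebraMap K (AlgebraicClosure K) (algebraMap ℚ K ((p : ℚ) ^ 2 / 3)) := by
      rw [hvAc, eq_ratCast (algebraMap ℚ K), map_ratCast, eq_ratCast]
    exact JZero.pow_three_smul_eq hvAc' g
  -- `g v_A / v_A = (g v_B / v_B)²`
  have hχ : ∀ g : Field.absoluteGaloisGroup K,
      (show AlgebraicClosure K ≃ₐ[K] AlgebraicClosure K from g) vA / vA =
        ((show AlgebraicClosure K ≃ₐ[K] AlgebraicClosure K from g) vB / vB) ^ 2 := by
    intro g
    rw [hvA, map_mul, map_pow, map_ofNat]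
    field_simp
  -- the `A`-transport at the GIVEN cube root `v_A` (its own cocycle is discarded: `ρ_A = ρ ∘ ρ`)
  obtain ⟨ψA, ρA, hψA, hρA, hlawA⟩ :=
    exists_cubicTwist_transport_of_eq (K := K) (b := 3 * (p : ℚ) ^ 2) (c := (p : ℚ) ^ 2 / 3)
      (by positivity) (by ring) hvAc
  -- `ρ g ∘ ρ g` has the coordinate description of the `v_A`-cocycle
  have hρρ : ∀ (g : Field.absoluteGaloisGroup K) {x y : AlgebraicClosure K}
      (h : (((cubeSumCurve 9).baseChange K).baseChange (AlgebraicClosure K)).toAffine.Nonsingular x y),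
      ∃ h', ρ g (ρ g (Affine.Point.some x y h)) =
        Affine.Point.some (((show AlgebraicClosure K ≃ₐ[K] AlgebraicClosure K from g) vA / vA) ^ 2 * x)
          y h' := by
    intro g x y h
    obtain ⟨h₁, e₁⟩ := hρ g h
    obtain ⟨h₂, e₂⟩ := hρ g h₁
    obtain ⟨h₃, e₃⟩ := hρA g h
    refine ⟨h₃, ?_⟩
    rw [e₁, e₂]
    exact Affine.Point.some_eq_some_of_eq (by rw [hχ]; ring) rfl
  -- hence `ρ_A g = ρ g ∘ ρ g` pointwise, and the `A`-twist law through `ρ ∘ ρ`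
  have hρAeq : ∀ (g : Field.absoluteGaloisGroup K) (P : geomPoints ((cubeSumCurve 9).baseChange K)),
      ρA g P = ρ g (ρ g P) := by
    intro g P
    change (((cubeSumCurve 9).baseChange K).baseChange (AlgebraicClosure K)).toAffine.Point at P
    rcases P with _ | ⟨x, y, h⟩
    · change ρA g 0 = ρ g (ρ g 0)
      rw [map_zero, map_zero, map_zero]
    · obtain ⟨h₁, e₁⟩ := hρA g h
      obtain ⟨h₂, e₂⟩ := hρρ g h
      rw [e₁, e₂]
  refine ⟨vB, vA, ψB, ψA, ρ, hvBc, hvB, hvA, hvAc, hvA0, hvB3, hvA3, hψB, hψA, hρ, hρρ, hlawB,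
    fun g P ↦ by rw [hlawA, hρAeq], hρcomm⟩


/-- **`Γ_K/N` is abelian for `N = Gal(K̄/emb K[m])`** — the binder `hcomm` of k-ty1 #14 (ring class fields
are abelian over `K`: x11b3 `isMulCommutative_ringClassGal'`; every `g ∈ Γ_K` restricts to `K[m]`,
`exists_algEquiv_comp_eq`). [cite: Cox2013, §9.A (pp. 180–181)] [cite: GrossLMS1991, §3 (𝒢_n)] -/
theorem commutator_mem_of_ringClassField (hK : IsImaginaryQuadratic K) (ι : K →+* ℂ) {m : ℕ} (hm : m ≠ 0)
    (emb : ringClassField K ι m →+* AlgebraicClosure K)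
    (hemb : ∀ k : K, emb (algebraMap K (ringClassField K ι m) k) = algebraMap K (AlgebraicClosure K) k)
    (N : Subgroup (Field.absoluteGaloisGroup K))
    (hN : ∀ g : Field.absoluteGaloisGroup K, g ∈ N ↔
      ∀ x : ringClassField K ι m, (show AlgebraicClosure K ≃ₐ[K] AlgebraicClosure K from g) (emb x) = emb x)
    (g h : Field.absoluteGaloisGroup K) : g * h * g⁻¹ * h⁻¹ ∈ N := by
  haveI := (finiteDimensional_and_isGalois_ringClassField hK ι hm).2
  obtain ⟨σ, hσ⟩ := exists_algEquiv_comp_eq emb hemb g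
  obtain ⟨τ, hτ⟩ := exists_algEquiv_comp_eq emb hemb h
  -- `σ`, `τ` commute: their `ℚ`-restrictions lie in the abelian `ringClassGal ι m`
  have hcommστ : ∀ x, σ (τ x) = τ (σ x) := by
    intro x
    have hσG : σ.restrictScalars ℚ ∈ ringClassGal ι m := by
      rw [ringClassGal, mem_fixingSubgroup_iff]
      rintro y ⟨k, hk⟩
      have hy : y = algebraMap K (ringClassField K ι m) k := Subtype.ext (by rw [coe_algebraMap_ringClassField]; exact hk.symm)
      rw [hy]; exact σ.commutes k
    have hτG : τ.restrictScalars ℚ ∈ ringClassGal ι m := by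
      rw [ringClassGal, mem_fixingSubgroup_iff]
      rintro y ⟨k, hk⟩
      have hy : y = algebraMap K (ringClassField K ι m) k := Subtype.ext (by rw [coe_algebraMap_ringClassField]; exact hk.symm)
      rw [hy]; exact τ.commutes k
    have hc := (KolyvaginH44.isMulCommutative_ringClassGal' hK ι m).is_comm.comm ⟨_, hσG⟩ ⟨_, hτG⟩
    have hc' := congrArg (fun e : ringClassGal ι m ↦ (e : ringClassField K ι m ≃ₐ[ℚ] ringClassField K ι m) x) hc
    exact hc'
  -- evaluate the commutator on `emb x`
  refine (hN _).mpr fun x ↦ ?_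
  have hg' : ∀ y, (show AlgebraicClosure K ≃ₐ[K] AlgebraicClosure K from g⁻¹) (emb y) = emb (σ.symm y) := by
    intro y
    have e := hσ (σ.symm y)
    rw [AlgEquiv.apply_symm_apply] at e
    -- `g (emb (σ⁻¹ y)) = emb y` ⇒ `g⁻¹ (emb y) = emb (σ⁻¹ y)`
    have : (show AlgebraicClosure K ≃ₐ[K] AlgebraicClosure K from g⁻¹)
        ((show AlgebraicClosure K ≃ₐ[K] AlgebraicClosure K from g) (emb (σ.symm y))) = emb (σ.symm y) := by
      change (g⁻¹ * g) • emb (σ.symm y) = emb (σ.symm y)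
      rw [inv_mul_cancel, one_smul]
    rw [e] at this
    exact this
  have hh' : ∀ y, (show AlgebraicClosure K ≃ₐ[K] AlgebraicClosure K from h⁻¹) (emb y) = emb (τ.symm y) := by
    intro y
    have e := hτ (τ.symm y)
    rw [AlgEquiv.apply_symm_apply] at e
    have : (show AlgebraicClosure K ≃ₐ[K] AlgebraicClosure K from h⁻¹)
        ((show AlgebraicClosure K ≃ₐ[K] AlgebraicClosure K from h) (emb (τ.symm y))) = emb (τ.symm y) := by
      change (h⁻¹ * h) • emb (τ.symm y) = emb (τ.symm y)
      rw [inv_mul_cancel, one_smul]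
    rw [e] at this
    exact this
  change (g * h * g⁻¹ * h⁻¹) • emb x = emb x
  rw [mul_smul, mul_smul, mul_smul]
  change (show AlgebraicClosure K ≃ₐ[K] AlgebraicClosure K from g)
      ((show AlgebraicClosure K ≃ₐ[K] AlgebraicClosure K from h)
        ((show AlgebraicClosure K ≃ₐ[K] AlgebraicClosure K from g⁻¹)
          ((show AlgebraicClosure K ≃ₐ[K] AlgebraicClosure K from h⁻¹) (emb x)))) = emb x
  rw [hh', hg', hτ, hσ, hcommστ, AlgEquiv.apply_symm_apply, AlgEquiv.apply_symm_apply]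

/-- **THE LEVEL PACKAGE of the coupled frame, in k-ty1 #14's shape.**  For the coupled frame
(`v_B, v_A = 3v_B², ψ_B, ψ_A, ρ` of `exists_coupledFrame`), an embedded `K[9pn]` (`emb`, `N` its fixing
subgroup, `n = ℓ` or `ℓℓ'` odd), the subgroup `N'` fixing the `K[9p]`-part and representatives `t` of
`Γ_K/N'`: `N'` (hence `N`) fixes `v_B` and `v_A`; both `ψ_B(E₉(K̄)^N)`, `ψ_A(E₉(K̄)^N)` are admissible at
`2^M`; and for EVERY `P ∈ E₉(K̄)^N` whose class mod `2^M E₉(K̄)^N` is `N'`-invariant (the `hP` of #R-c /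
#R-f for the derived CM points) the two `χ`-components `ψ_B(Σᵢ ρ(tᵢ)(tᵢ • P))`, `ψ_A(Σᵢ ρ(tᵢ)(ρ(tᵢ)(tᵢ • P)))`
lie in `invPoints Γ_K A_B 2^M`, `invPoints Γ_K A_A 2^M` — the binders `hA₁ hA₂ hP₁ hP₂` of #14.
[cite: GrossLMS1991, §4 (4.1)–(4.4), Lemma 4.3, §12] [cite: HuShuYin2019, §2 Prop. 2.4, p. 8] -/
theorem coupledFrame_levelPackage {ω : K} (hω : ω ^ 2 + ω + 1 = 0) (h2 : Module.finrank ℚ K = 2)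
    (ι : K →+* ℂ) {p n : ℕ} (hp0 : p ≠ 0) (hn0 : n ≠ 0) (hp2 : Odd p) (hn2 : Odd n)
    {vB vA : AlgebraicClosure K} (hvBc : vB ^ 3 = algebraMap ℚ (AlgebraicClosure K) ((p : ℚ) / 9))
    (hvB : vB ≠ 0)
    (hvAc : vA ^ 3 = algebraMap ℚ (AlgebraicClosure K) ((p : ℚ) ^ 2 / 3)) (hvA0 : vA ≠ 0)
    (hvB3 : ∀ g : Field.absoluteGaloisGroup K,
      ((show AlgebraicClosure K ≃ₐ[K] AlgebraicClosure K from g) vB) ^ 3 = vB ^ 3)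
    (hvA3 : ∀ g : Field.absoluteGaloisGroup K,
      ((show AlgebraicClosure K ≃ₐ[K] AlgebraicClosure K from g) vA) ^ 3 = vA ^ 3)
    {ψB : geomPoints ((cubeSumCurve 9).baseChange K) ≃+ geomPoints ((cubeSumCurve (p : ℚ)).baseChange K)}
    {ψA : geomPoints ((cubeSumCurve 9).baseChange K) ≃+
      geomPoints ((cubeSumCurve (3 * (p : ℚ) ^ 2)).baseChange K)}
    {ρ : Field.absoluteGaloisGroup K →
      geomPoints ((cubeSumCurve 9).baseChange K) ≃+ geomPoints ((cubeSumCurve 9).baseChange K)}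
    (hρ : ∀ (g : Field.absoluteGaloisGroup K) {x y : AlgebraicClosure K}
        (h : (((cubeSumCurve 9).baseChange K).baseChange (AlgebraicClosure K)).toAffine.Nonsingular x y),
        ∃ h', ρ g (Affine.Point.some x y h) =
          Affine.Point.some (((show AlgebraicClosure K ≃ₐ[K] AlgebraicClosure K from g) vB / vB) ^ 2 * x)
            y h')
    (hρρ : ∀ (g : Field.absoluteGaloisGroup K) {x y : AlgebraicClosure K}
        (h : (((cubeSumCurve 9).baseChange K).baseChange (AlgebraicClosure K)).toAffine.Nonsingular x y),
        ∃ h', ρ g (ρ g (Affine.Point.some x y h)) =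
          Affine.Point.some (((show AlgebraicClosure K ≃ₐ[K] AlgebraicClosure K from g) vA / vA) ^ 2 * x)
            y h')
    (hlawB : ∀ (g : Field.absoluteGaloisGroup K) (P : geomPoints ((cubeSumCurve 9).baseChange K)),
        g • ψB P = ψB (ρ g (g • P)))
    (hlawA : ∀ (g : Field.absoluteGaloisGroup K) (P : geomPoints ((cubeSumCurve 9).baseChange K)),
        g • ψA P = ψA (ρ g (ρ g (g • P))))
    (emb : ringClassField K ι (9 * p * n) →+* AlgebraicClosure K)
    (hemb : ∀ k : K, emb (algebraMap K (ringClassField K ι (9 * p * n)) k) =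
      algebraMap K (AlgebraicClosure K) k)
    (N : Subgroup (Field.absoluteGaloisGroup K))
    (hN : ∀ g : Field.absoluteGaloisGroup K, g ∈ N ↔
      ∀ x : ringClassField K ι (9 * p * n),
        (show AlgebraicClosure K ≃ₐ[K] AlgebraicClosure K from g) (emb x) = emb x)
    (N' : Subgroup (Field.absoluteGaloisGroup K))
    (hN' : ∀ g : Field.absoluteGaloisGroup K, g ∈ N' ↔
      ∀ x ∈ {x : ringClassField K ι (9 * p * n) | (x : ℂ) ∈ ringClassField K ι (9 * p)},
        (show AlgebraicClosure K ≃ₐ[K] AlgebraicClosure K from g) (emb x) = emb x)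
    {ιt : Type*} [Fintype ιt] (t : ιt → Field.absoluteGaloisGroup K)
    (ht : Function.Bijective fun i ↦ (t i : Field.absoluteGaloisGroup K ⧸ N')) (M : ℕ)
    (P : geomPoints ((cubeSumCurve 9).baseChange K))
    (hPN : P ∈ FixedPoints.addSubgroup N (geomPoints ((cubeSumCurve 9).baseChange K)))
    (hP : ∀ h ∈ N', ∃ a ∈ FixedPoints.addSubgroup N (geomPoints ((cubeSumCurve 9).baseChange K)),
      ((2 ^ M : ℕ) : ℤ) • a = h • P - P) :
    N.Normal ∧ (∀ g h : Field.absoluteGaloisGroup K, g * h * g⁻¹ * h⁻¹ ∈ N) ∧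
    (∀ h ∈ N', (show AlgebraicClosure K ≃ₐ[K] AlgebraicClosure K from h) vB = vB) ∧
    (∀ h ∈ N', (show AlgebraicClosure K ≃ₐ[K] AlgebraicClosure K from h) vA = vA) ∧
    (∀ h ∈ N, (show AlgebraicClosure K ≃ₐ[K] AlgebraicClosure K from h) vB = vB) ∧
    KolyvaginCocycle.IsAdmissible (Field.absoluteGaloisGroup K)
      ((FixedPoints.addSubgroup N (geomPoints ((cubeSumCurve 9).baseChange K))).map ψB.toAddMonoidHom)
      ((2 ^ M : ℕ) : ℤ) ∧
    KolyvaginCocycle.IsAdmissible (Field.absoluteGaloisGroup K)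
      ((FixedPoints.addSubgroup N (geomPoints ((cubeSumCurve 9).baseChange K))).map ψA.toAddMonoidHom)
      ((2 ^ M : ℕ) : ℤ) ∧
    ψB (∑ i, ρ (t i) (t i • P)) ∈ KolyvaginCocycle.invPoints (Field.absoluteGaloisGroup K)
      ((FixedPoints.addSubgroup N (geomPoints ((cubeSumCurve 9).baseChange K))).map ψB.toAddMonoidHom)
      ((2 ^ M : ℕ) : ℤ) ∧
    ψA (∑ i, ρ (t i) (ρ (t i) (t i • P))) ∈ KolyvaginCocycle.invPoints (Field.absoluteGaloisGroup K)
      ((FixedPoints.addSubgroup N (geomPoints ((cubeSumCurve 9).baseChange K))).map ψA.toAddMonoidHom)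
      ((2 ^ M : ℕ) : ℤ) := by
  have hK := JZero.isImaginaryQuadratic_of_sq_add_self_add_one hω h2
  have hdK := JZero.discr_eq_neg_three_of_sq_add_self_add_one hω h2
  have hm0 : 9 * p * n ≠ 0 := mul_ne_zero (mul_ne_zero (by norm_num) hp0) hn0
  haveI := (finiteDimensional_and_isGalois_ringClassField hK ι hm0).2
  haveI hNn : N.Normal := normal_of_mem_iff emb hemb N hN
  have hNN' : N ≤ N' := le_of_mem_iff_of_mem_iff_forall emb hN hN'
  -- `N'` fixes the cube roots of `p/9` and `p²/3`
  have hN'B := forall_apply_eq_of_pow_three_eq_div_nine_of_fix_nine_mul hω h2 ι hp0 hn0 emb hemb N' hN'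
  have hN'A := forall_apply_eq_of_pow_three_eq_sq_div_three_of_fix_nine_mul hω h2 ι hp0 hn0 emb hemb N' hN'
  have hN'vB : ∀ h ∈ N', (show AlgebraicClosure K ≃ₐ[K] AlgebraicClosure K from h) vB = vB :=
    fun h hh ↦ hN'B h hh vB hvBc
  have hN'vA : ∀ h ∈ N', (show AlgebraicClosure K ≃ₐ[K] AlgebraicClosure K from h) vA = vA :=
    fun h hh ↦ hN'A h hh vA hvAc
  have hNvB : ∀ h ∈ N, (show AlgebraicClosure K ≃ₐ[K] AlgebraicClosure K from h) vB = vB :=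
    fun h hh ↦ hN'vB h (hNN' hh)
  have h6 := pow_three_ne_six_of_fix_sylvester_prime hK hdK ι hp2 hn2 emb hemb N hN
  -- the `ρ ∘ ρ` family as additive equivalences, for the `A`-side calls
  have hρρ' : ∀ (g : Field.absoluteGaloisGroup K) {x y : AlgebraicClosure K}
      (h : (((cubeSumCurve 9).baseChange K).baseChange (AlgebraicClosure K)).toAffine.Nonsingular x y),
      ∃ h', (fun g ↦ (ρ g).trans (ρ g)) g (Affine.Point.some x y h) =
        Affine.Point.some (((show AlgebraicClosure K ≃ₐ[K] AlgebraicClosure K from g) vA / vA) ^ 2 * x)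
          y h' := fun g x y h ↦ hρρ g h
  have hlawA' : ∀ (g : Field.absoluteGaloisGroup K) (P : geomPoints ((cubeSumCurve 9).baseChange K)),
      g • ψA P = ψA ((fun g ↦ (ρ g).trans (ρ g)) g (g • P)) := fun g P ↦ hlawA g P
  refine ⟨hNn, commutator_mem_of_ringClassField hK ι hm0 emb hemb N hN, hN'vB, hN'vA, hNvB,
    isAdmissible_map_fixedPoints_cubeSumCurve_nine K hω hvB hvB3 hρ hlawB N h6 M,
    isAdmissible_map_fixedPoints_cubeSumCurve_nine K hω hvA0 hvA3 hρρ' hlawA' N h6 M,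
    JZero.cubicTwist_chiComponent_fixedPoints_mem_invPoints hω hvB hvB3 hρ hlawB N hN'vB t ht hPN hP, ?_⟩
  exact JZero.cubicTwist_chiComponent_fixedPoints_mem_invPoints hω hvA0 hvA3 hρρ' hlawA' N hN'vA t ht hPN hP

end Summit.BirchSwinnertonDyer.BirchSwinnertonDyer.Theorems.SylvesterTwoCMData

end
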